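import Summits.Ventures.LatticeQCDFlow.Exactness.FlowSamplerOperator
import Summits.Ventures.LatticeQCDFlow.Exactness.Phi4IndependenceSamplerReversible
import HarnessLib

/-!
# The flow sampler's operator is POSITIVE on `L²(w dμ)`: `⟨g, K g⟩_w ≥ ∫ g² w r ≥ 0`

HONEST FRAMING: exact (Metropolis-corrected) sampling algorithms for lattice gauge theory;
figures of merit are autocorrelation/cost numbers at stated couplings and volumes; no
continuum-physics claim.  (SCALAR calibration rung S0-A: not a gauge result.)

Venture `LatticeQCDFlow` (cell pub-lqcd), topic `Exactness`; FANOUT row 2 (`s0-phi4`, FLOW arm: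
real-NVP proposals + independence-Metropolis accept/reject).  NEW WORK of the cell over Mathlib and
row 2's `Exactness/FlowSamplerOperator.lean` (the named operator `imhOp μ w q`, acceptance
`imhAcceptQ`), `Exactness/Phi4IndependenceSamplerExact.lean` (the symmetrised flow `imhFlow`) and
`Exactness/Phi4IndependenceSamplerReversible.lean` (`imh_line`).  Nothing is cited as a fact.
Printed counterparts, NAMED ONLY: Liu, Statist. Comput. 6 (1996) 113 (the independence sampler's
spectrum lies in `[0, 1]`, finite state space); row 11's `Scoring/IMHPositiveCorrelations.lean` is
the cell's finite-state (`Fintype`, matrix) version of the same positivity.  This file is the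
GENERAL-STATE-SPACE version that row 2's sampler on `ℝ^Λ` needs, by a layer-cake/Fubini argument
instead of sorting states.

## What is proved (general `(X, μ)` s-finite; weight `w > 0` integrable, proposal density `q > 0`
with `∫ q dμ = 1`; `K = imhOp μ w q`; `g` bounded measurable, NO centring or weight bound needed)

* §0–§1 `integral_Ioi_ite_lt` (layer cake on the half line), `imhFlow_eq_mul_min`
  (`min(w q', w' q) = q q' min(b, b')`, `b = w/q` the importance ratio) and
  **`integral_integral_imhFlow_eq_sq`**:
  `∫∫ s(t,t') g(t') g(t) dμ dμ = ∫_{u>0} (∫ 1[u < b] g q dμ)² du` — the symmetrised flow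
  `s = min(w q', w' q)` is a positive-semidefinite kernel (triple Fubini over `μ ⊗ μ ⊗ du`, the
  integrand dominated by `B² q ⊗ w`);
* §2 `rejection_bounds` (the rejection probability `r(t) = ∫ (1 − α(t,t')) q(t') dμ(t') ∈ [0,1]`,
  measurable), `mul_imhOp_mul_eq` (pointwise split
  `g (K g) w = ∫ s(t,·) g g(t) + g² w r`), **`integral_mul_imhOp_mul_eq`**:
  `∫ g (K g) w dμ = ∫_{u>0} (∫ 1[u < b] g q)² du + ∫ g² w r dμ`, hence
  **`integral_sq_mul_rejection_le`** `∫ g² w r ≤ ∫ g (K g) w` and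
  **`integral_mul_imhOp_mul_nonneg`** `0 ≤ ∫ g (K g) w` — the exact flow sampler's one-step
  operator is POSITIVE on `L²(w dμ)`; the Metropolis rejection can only ADD lag-one correlation.

Consequences (all autocovariances `≥ 0`, log-convexity, `ρ(n) ≥ ρ(1)ⁿ`, monotone windows, the
floor `τ_int ≥ (1 + ρ(1))/(2(1 − ρ(1)))` and the lattice instances) are in
`Exactness/FlowSamplerLogConvex.lean` and `Exactness/FlowSamplerTauIntFloor.lean`.
NOT CLAIMED: anything for HMC or local Metropolis (not positive operators in general); unbounded
observables; any number for a trained network.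
-/

namespace Summit.Ventures.LatticeQCDFlow.Exactness

open Real MeasureTheory Filter Finset Set

/-! ## §0 Two real-line lemmas: the layer cake on the half line -/

/-- Product of two cut-offs is the cut-off at the minimum. -/
theorem ite_lt_mul_ite_lt (u x y c d : ℝ) :
    (if u < x then c else 0) * (if u < y then d else 0) = if u < min x y then c * d else 0 := by
  by_cases hx : u < x
  · by_cases hy : u < y
    · rw [if_pos hx, if_pos hy, if_pos (lt_min hx hy)]
    · rw [if_pos hx, if_neg hy, if_neg (fun h => hy (lt_min_iff.1 h).2), mul_zero]
  · rw [if_neg hx, zero_mul, if_neg (fun h => hx (lt_min_iff.1 h).1)]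

/-- Layer cake on the half line: `∫_{u>0} 1[u < m]·e du = m·e` for `m ≥ 0`. -/
theorem integral_Ioi_ite_lt {m : ℝ} (hm : 0 ≤ m) (e : ℝ) :
    ∫ u in Ioi (0:ℝ), (if u < m then e else 0) = m * e := by
  have h : (fun u : ℝ => if u < m then e else 0) = (Iio m).indicator (fun _ => e) := by
    funext u
    simp only [Set.indicator, Set.mem_Iio]
  rw [h, integral_indicator measurableSet_Iio, Measure.restrict_restrict measurableSet_Iio,
    setIntegral_const, measureReal_def, Iio_inter_Ioi, Real.volume_Ioo, sub_zero,
    ENNReal.toReal_ofReal hm, smul_eq_mul]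

/-! ## §1 General state space: the symmetrised flow is a positive-semidefinite kernel -/

section General

variable {X : Type*} [MeasurableSpace X] {μ : Measure X} {w q : X → ℝ}

omit [MeasurableSpace X] in
/-- The symmetrised flow factors through the importance ratio `b = w/q`:
`min(w q', w' q) = q q' · min(b, b')`. -/
theorem imhFlow_eq_mul_min (hq0 : ∀ t, 0 < q t) (t t' : X) :
    imhFlow w q t t' = q t * q t' * min (w t / q t) (w t' / q t') := by
  unfold imhFlow
  have hqt : q t ≠ 0 := (hq0 t).ne'
  have hqt' : q t' ≠ 0 := (hq0 t').ne'
  rw [mul_min_of_nonneg _ _ (mul_pos (hq0 t) (hq0 t')).le]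
  have h1 : q t * q t' * (w t / q t) = w t * q t' := by
    field_simp
  have h2 : q t * q t' * (w t' / q t') = w t' * q t := by
    field_simp
  rw [h1, h2]

omit [MeasurableSpace X] in
/-- The flow is dominated by the product weight: `0 ≤ s(t,t') ≤ w t · q t'`. -/
theorem imhFlow_nonneg_le (hw0 : ∀ t, 0 < w t) (hq0 : ∀ t, 0 < q t) (t t' : X) :
    0 ≤ imhFlow w q t t' ∧ imhFlow w q t t' ≤ w t * q t' := by
  unfold imhFlow
  exact ⟨le_min (mul_nonneg (hw0 t).le (hq0 t').le) (mul_nonneg (hw0 t').le (hq0 t).le),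
    min_le_left _ _⟩

variable [SFinite μ]

/-- **THE OFF-DIAGONAL FORM IS A SQUARE INTEGRAL (layer cake).**  For bounded measurable `g`:
`∫∫ s(t,t') g(t') g(t) dμ dμ = ∫_{u>0} (∫ 1[u < w/q] · g · q dμ)² du`, where
`s = min(w q', w' q)` is the symmetrised flow of the independence sampler.  In particular the
left-hand side is nonnegative: the `min` kernel in the importance ratio is positive semidefinite. -/
theorem integral_integral_imhFlow_eq_sq (hw0 : ∀ t, 0 < w t) (hwm : Measurable w)
    (hwi : Integrable w μ) (hq0 : ∀ t, 0 < q t) (hqm : Measurable q) (hqi : Integrable q μ)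
    {g : X → ℝ} (hgm : Measurable g) {B : ℝ} (hgb : ∀ t, |g t| ≤ B) :
    ∫ t, ∫ t', imhFlow w q t t' * g t' * g t ∂μ ∂μ
      = ∫ u in Ioi (0:ℝ), (∫ t, (if u < w t / q t then g t * q t else 0) ∂μ) ^ 2 := by
  set ν : Measure ℝ := volume.restrict (Ioi 0) with hν
  -- the cut-off observable `c u t = 1[u < b t] g t q t`, jointly measurable in `(t, u)`
  set c : ℝ → X → ℝ := fun u t => if u < w t / q t then g t * q t else 0 with hc
  have hbm : Measurable fun t => w t / q t := hwm.div hqm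
  have hb0 : ∀ t, 0 < w t / q t := fun t => div_pos (hw0 t) (hq0 t)
  have hcm : Measurable fun z : X × ℝ => c z.2 z.1 := by
    simp only [hc]
    exact Measurable.ite (measurableSet_lt measurable_snd (hbm.comp measurable_fst))
      ((hgm.mul hqm).comp measurable_fst) measurable_const
  -- the integrand on `(X × X) × ℝ`
  have hFm : Measurable fun z : (X × X) × ℝ => c z.2 z.1.1 * c z.2 z.1.2 :=
    (hcm.comp ((measurable_fst.comp measurable_fst).prodMk measurable_snd)).mul
      (hcm.comp ((measurable_snd.comp measurable_fst).prodMk measurable_snd))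
  -- pointwise in `(t, t')`: the `u`-integral of the product of cut-offs is the flow term
  have hprod_eq : ∀ (u : ℝ) (t t' : X), c u t * c u t'
      = if u < min (w t / q t) (w t' / q t') then g t * q t * (g t' * q t') else 0 := by
    intro u t t'
    simp only [hc]
    exact ite_lt_mul_ite_lt u _ _ _ _
  have hmin0 : ∀ t t', 0 ≤ min (w t / q t) (w t' / q t') := fun t t' =>
    le_min (hb0 t).le (hb0 t').le
  have hF_eq : ∀ t t', ∫ u, c u t * c u t' ∂ν = imhFlow w q t t' * g t' * g t := by
    intro t t'
    simp_rw [hprod_eq]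
    rw [hν, integral_Ioi_ite_lt (hmin0 t t'), imhFlow_eq_mul_min hq0]
    ring
  have hnorm_eq : ∀ t t', ∫ u, ‖c u t * c u t'‖ ∂ν
      = min (w t / q t) (w t' / q t') * (|g t| * q t * (|g t'| * q t')) := by
    intro t t'
    have e : ∀ u, ‖c u t * c u t'‖
        = if u < min (w t / q t) (w t' / q t') then |g t| * q t * (|g t'| * q t') else 0 := by
      intro u
      rw [hprod_eq, Real.norm_eq_abs]
      split_ifs
      · rw [abs_mul, abs_mul, abs_mul, abs_of_pos (hq0 t), abs_of_pos (hq0 t')]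
      · exact abs_zero
    simp_rw [e]
    rw [hν, integral_Ioi_ite_lt (hmin0 t t')]
  -- integrability on the triple product
  have hFint : Integrable (fun z : (X × X) × ℝ => c z.2 z.1.1 * c z.2 z.1.2) ((μ.prod μ).prod ν) := by
    rw [integrable_prod_iff hFm.aestronglyMeasurable]
    constructor
    · refine Eventually.of_forall fun p => ?_
      have e : (fun u => c u p.1 * c u p.2)
          = (Iio (min (w p.1 / q p.1) (w p.2 / q p.2))).indicator
              (fun _ => g p.1 * q p.1 * (g p.2 * q p.2)) := by
        funext u
        rw [hprod_eq]
        simp only [Set.indicator, Set.mem_Iio]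
      rw [e, integrable_indicator_iff measurableSet_Iio]
      refine integrableOn_const ?_
      rw [hν, Measure.restrict_apply measurableSet_Iio, Iio_inter_Ioi, Real.volume_Ioo]
      exact ENNReal.ofReal_ne_top
    · have e : (fun p : X × X => ∫ u, ‖c u p.1 * c u p.2‖ ∂ν)
          = fun p => min (w p.1 / q p.1) (w p.2 / q p.2) * (|g p.1| * q p.1 * (|g p.2| * q p.2)) := by
        funext p
        exact hnorm_eq p.1 p.2
      rw [e]
      have hG : Integrable (fun p : X × X => q p.1 * w p.2) (μ.prod μ) := hqi.mul_prod hwi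
      refine Integrable.mono' (hG.const_mul (B ^ 2))
        ((((hbm.comp measurable_fst).min (hbm.comp measurable_snd)).mul
          ((((continuous_abs.measurable.comp (hgm.comp measurable_fst))).mul
            (hqm.comp measurable_fst)).mul
            ((continuous_abs.measurable.comp (hgm.comp measurable_snd)).mul
              (hqm.comp measurable_snd)))).aestronglyMeasurable)
        (Eventually.of_forall fun p => ?_)
      have hB : 0 ≤ B := (abs_nonneg _).trans (hgb p.1)
      have hq1p : 0 < q p.1 := hq0 p.1
      have hq2p : 0 < q p.2 := hq0 p.2
      have hmin_le : min (w p.1 / q p.1) (w p.2 / q p.2) ≤ w p.2 / q p.2 := min_le_right _ _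
      rw [Real.norm_eq_abs, abs_of_nonneg (mul_nonneg (hmin0 p.1 p.2) (mul_nonneg
        (mul_nonneg (abs_nonneg _) hq1p.le) (mul_nonneg (abs_nonneg _) hq2p.le)))]
      calc min (w p.1 / q p.1) (w p.2 / q p.2) * (|g p.1| * q p.1 * (|g p.2| * q p.2))
          ≤ (w p.2 / q p.2) * (B * q p.1 * (B * q p.2)) := by
            refine mul_le_mul hmin_le ?_ (mul_nonneg (mul_nonneg (abs_nonneg _) hq1p.le)
              (mul_nonneg (abs_nonneg _) hq2p.le)) (hb0 p.2).le
            exact mul_le_mul (mul_le_mul_of_nonneg_right (hgb _) hq1p.le)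
              (mul_le_mul_of_nonneg_right (hgb _) hq2p.le)
              (mul_nonneg (abs_nonneg _) hq2p.le) (mul_nonneg hB hq1p.le)
        _ = B ^ 2 * (q p.1 * w p.2) := by
            field_simp
  -- Fubini: `∫_t ∫_t' ∫_u = ∫_{(t,t')} ∫_u = ∫_u ∫_{(t,t')} = ∫_u (∫_t c)(∫_t' c)`
  calc ∫ t, ∫ t', imhFlow w q t t' * g t' * g t ∂μ ∂μ
      = ∫ t, ∫ t', ∫ u, c u t * c u t' ∂ν ∂μ ∂μ := by
        simp_rw [hF_eq]
    _ = ∫ p, ∫ u, c u p.1 * c u p.2 ∂ν ∂(μ.prod μ) :=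
        (integral_prod (fun p : X × X => ∫ u, c u p.1 * c u p.2 ∂ν) hFint.integral_prod_left).symm
    _ = ∫ u, ∫ p, c u p.1 * c u p.2 ∂(μ.prod μ) ∂ν :=
        integral_integral_swap (f := fun (p : X × X) (u : ℝ) => c u p.1 * c u p.2) hFint
    _ = ∫ u, (∫ t, c u t ∂μ) ^ 2 ∂ν := by
        refine integral_congr_ae (Eventually.of_forall fun u => ?_)
        dsimp only
        rw [sq]
        exact integral_prod_mul (fun t => c u t) (fun t => c u t)

/-! ## §2 `⟨g, K g⟩_w ≥ ∫ g² (1 − A) w ≥ 0`: the operator is positive -/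

omit [SFinite μ] in
/-- Bounded measurable `a`, `b` against the integrable weight: `a·b·w ∈ L¹`. -/
theorem integrable_mul_mul_weight (hw0 : ∀ t, 0 < w t) (hwm : Measurable w) (hwi : Integrable w μ)
    {a b : X → ℝ} (ham : Measurable a) (hbm : Measurable b) {Ba Bb : ℝ} (hab : ∀ t, |a t| ≤ Ba)
    (hbb : ∀ t, |b t| ≤ Bb) : Integrable (fun t => a t * b t * w t) μ := by
  refine Integrable.mono' (hwi.const_mul (Ba * Bb)) ((ham.mul hbm).mul hwm).aestronglyMeasurable
    (Eventually.of_forall fun t => ?_)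
  rw [Real.norm_eq_abs, abs_mul, abs_mul, abs_of_pos (hw0 t)]
  refine mul_le_mul_of_nonneg_right ?_ (hw0 t).le
  exact mul_le_mul (hab t) (hbb t) (abs_nonneg _) ((abs_nonneg _).trans (hab t))

omit [SFinite μ] in
/-- `s(t,t')·a(t')·b(t) ∈ L¹(μ ⊗ μ)` for bounded measurable `a`, `b` (dominated by `w ⊗ q`). -/
theorem integrable_imhFlow_mul_mul (hw0 : ∀ t, 0 < w t) (hwm : Measurable w) (hwi : Integrable w μ)
    (hq0 : ∀ t, 0 < q t) (hqm : Measurable q) (hqi : Integrable q μ) {a b : X → ℝ}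
    (ham : Measurable a) (hbm : Measurable b) {Ba Bb : ℝ} (hab : ∀ t, |a t| ≤ Ba)
    (hbb : ∀ t, |b t| ≤ Bb) :
    Integrable (fun p : X × X => imhFlow w q p.1 p.2 * a p.2 * b p.1) (μ.prod μ) := by
  have hG : Integrable (fun p : X × X => w p.1 * q p.2) (μ.prod μ) := hwi.mul_prod hqi
  have hsm : Measurable fun p : X × X => imhFlow w q p.1 p.2 := by
    unfold imhFlow
    exact ((hwm.comp measurable_fst).mul (hqm.comp measurable_snd)).min
      ((hwm.comp measurable_snd).mul (hqm.comp measurable_fst))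
  refine Integrable.mono' (hG.const_mul (Ba * Bb))
    ((hsm.mul (ham.comp measurable_snd)).mul (hbm.comp measurable_fst)).aestronglyMeasurable
    (Eventually.of_forall fun p => ?_)
  obtain ⟨hs0, hsle⟩ := imhFlow_nonneg_le hw0 hq0 p.1 p.2
  have hBa : 0 ≤ Ba := (abs_nonneg _).trans (hab p.2)
  rw [Real.norm_eq_abs, abs_mul, abs_mul, abs_of_nonneg hs0]
  calc imhFlow w q p.1 p.2 * |a p.2| * |b p.1| ≤ (w p.1 * q p.2) * Ba * Bb :=
        mul_le_mul (mul_le_mul hsle (hab _) (abs_nonneg _) (mul_nonneg (hw0 _).le (hq0 _).le))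
          (hbb _) (abs_nonneg _) (mul_nonneg (mul_nonneg (hw0 _).le (hq0 _).le) hBa)
    _ = Ba * Bb * (w p.1 * q p.2) := by ring

/-- The REJECTION PROBABILITY from `t`, `r(t) = ∫ (1 − α(t,t')) q(t') dμ(t')`, lies in `[0, 1]`,
and `t ↦ r(t)` is measurable. -/
theorem rejection_bounds (hw0 : ∀ t, 0 < w t) (hwm : Measurable w) (hq0 : ∀ t, 0 < q t)
    (hqm : Measurable q) (hqi : Integrable q μ) (hq1 : ∫ t, q t ∂μ = 1) :
    (∀ t, 0 ≤ ∫ t', (1 - imhAcceptQ w q t t') * q t' ∂μ)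
      ∧ (∀ t, ∫ t', (1 - imhAcceptQ w q t t') * q t' ∂μ ≤ 1)
      ∧ Measurable fun t => ∫ t', (1 - imhAcceptQ w q t t') * q t' ∂μ := by
  refine ⟨fun t => integral_nonneg fun t' => mul_nonneg
      (sub_nonneg.2 (imhAcceptQ_le_one w q t t')) (hq0 t').le, fun t => ?_, ?_⟩
  · calc ∫ t', (1 - imhAcceptQ w q t t') * q t' ∂μ ≤ ∫ t', q t' ∂μ := by
          refine integral_mono_of_nonneg (Eventually.of_forall fun t' => mul_nonneg
            (sub_nonneg.2 (imhAcceptQ_le_one w q t t')) (hq0 t').le) hqi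
            (Eventually.of_forall fun t' => ?_)
          have h0 := imhAcceptQ_nonneg hw0 hq0 t t'
          have hq := hq0 t'
          nlinarith
      _ = 1 := hq1
  · have hF : Measurable fun p : X × X => (1 - imhAcceptQ w q p.1 p.2) * q p.2 :=
      (measurable_const.sub (measurable_imhAcceptQ hwm hqm)).mul (hqm.comp measurable_snd)
    exact (hF.stronglyMeasurable.integral_prod_right' (ν := μ)).measurable

omit [SFinite μ] in
/-- **Pointwise split of `g·(K g)·w`** into the symmetric off-diagonal part and the rejection part:
`g(t) (K g)(t) w(t) = ∫ s(t,t') g(t') g(t) dμ(t') + g(t)² w(t) r(t)`. -/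
theorem mul_imhOp_mul_eq (hw0 : ∀ t, 0 < w t) (hwm : Measurable w) (hq0 : ∀ t, 0 < q t)
    (hqm : Measurable q) (hqi : Integrable q μ) (hq1 : ∫ t, q t ∂μ = 1) {g : X → ℝ}
    (hgm : Measurable g) {B : ℝ} (hgb : ∀ t, |g t| ≤ B) (t : X) :
    g t * imhOp μ w q g t * w t
      = (∫ t', imhFlow w q t t' * g t' * g t ∂μ)
        + g t ^ 2 * w t * ∫ t', (1 - imhAcceptQ w q t t') * q t' ∂μ := by
  have ham : Measurable fun t' => imhAcceptQ w q t t' :=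
    (measurable_imhAcceptQ hwm hqm).comp (measurable_const.prodMk measurable_id)
  have hαq : Integrable (fun t' => imhAcceptQ w q t t' * q t') μ := by
    refine Integrable.mono' hqi (ham.mul hqm).aestronglyMeasurable
      (Eventually.of_forall fun t' => ?_)
    rw [Real.norm_eq_abs, abs_mul, abs_of_nonneg (imhAcceptQ_nonneg hw0 hq0 t t'),
      abs_of_pos (hq0 t')]
    exact mul_le_of_le_one_left (hq0 t').le (imhAcceptQ_le_one w q t t')
  have hrej : ∫ t', (1 - imhAcceptQ w q t t') * q t' ∂μ
      = 1 - ∫ t', imhAcceptQ w q t t' * q t' ∂μ := by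
    have e : ∀ t', (1 - imhAcceptQ w q t t') * q t' = q t' - imhAcceptQ w q t t' * q t' :=
      fun t' => by ring
    simp_rw [e]
    rw [integral_sub hqi hαq, hq1]
  have hdiag : ∫ t', imhFlow w q t t' * g t * g t ∂μ
      = (∫ t', imhAcceptQ w q t t' * q t' ∂μ) * (g t * g t * w t) := by
    rw [← integral_mul_const]
    refine integral_congr_ae (Eventually.of_forall fun t' => ?_)
    dsimp only
    rw [← imh_accept_mul_weight w q (hw0 t) (hq0 t')]
    unfold imhAcceptQ
    ring
  calc g t * imhOp μ w q g t * w t = imhOp μ w q g t * g t * w t := by ring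
    _ = (∫ t', imhFlow w q t t' * g t' * g t ∂μ) + g t * g t * w t * (∫ t', q t' ∂μ)
        - ∫ t', imhFlow w q t t' * g t * g t ∂μ := by
        unfold imhOp imhAcceptQ
        exact imh_line hw0 hwm hq0 hqm hqi hgm hgb t (g t)
    _ = (∫ t', imhFlow w q t t' * g t' * g t ∂μ)
        + g t ^ 2 * w t * ∫ t', (1 - imhAcceptQ w q t t') * q t' ∂μ := by
        rw [hq1, hdiag, hrej]
        ring

/-- **`⟨g, K g⟩_w` DECOMPOSED**: for every bounded measurable `g`,
`∫ g (K g) w dμ = ∫_{u>0} (∫ 1[u < w/q] g q dμ)² du + ∫ g² w r dμ` — a square integral plus the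
rejection term. -/
theorem integral_mul_imhOp_mul_eq (hw0 : ∀ t, 0 < w t) (hwm : Measurable w) (hwi : Integrable w μ)
    (hq0 : ∀ t, 0 < q t) (hqm : Measurable q) (hqi : Integrable q μ) (hq1 : ∫ t, q t ∂μ = 1)
    {g : X → ℝ} (hgm : Measurable g) {B : ℝ} (hgb : ∀ t, |g t| ≤ B) :
    ∫ t, g t * imhOp μ w q g t * w t ∂μ
      = (∫ u in Ioi (0:ℝ), (∫ t, (if u < w t / q t then g t * q t else 0) ∂μ) ^ 2)
        + ∫ t, g t ^ 2 * w t * (∫ t', (1 - imhAcceptQ w q t t') * q t' ∂μ) ∂μ := by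
  obtain ⟨hr0, hr1, hrm⟩ := rejection_bounds (μ := μ) hw0 hwm hq0 hqm hqi hq1
  have hI1 : Integrable (fun t => ∫ t', imhFlow w q t t' * g t' * g t ∂μ) μ :=
    (integrable_imhFlow_mul_mul hw0 hwm hwi hq0 hqm hqi hgm hgm hgb hgb).integral_prod_left
  have hg2b : ∀ t, |g t ^ 2| ≤ B ^ 2 := fun t => by
    rw [abs_pow]; exact pow_le_pow_left₀ (abs_nonneg _) (hgb t) 2
  have hrb : ∀ t, |∫ t', (1 - imhAcceptQ w q t t') * q t' ∂μ| ≤ 1 := fun t => by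
    rw [abs_of_nonneg (hr0 t)]; exact hr1 t
  have hI2 : Integrable (fun t => g t ^ 2 * w t * ∫ t', (1 - imhAcceptQ w q t t') * q t' ∂μ) μ := by
    have h := integrable_mul_mul_weight hw0 hwm hwi (hgm.pow_const 2) hrm hg2b hrb
    refine h.congr (Eventually.of_forall fun t => ?_)
    dsimp only
    ring
  rw [integral_congr_ae (Eventually.of_forall fun t =>
      mul_imhOp_mul_eq hw0 hwm hq0 hqm hqi hq1 hgm hgb t), integral_add hI1 hI2,
    integral_integral_imhFlow_eq_sq hw0 hwm hwi hq0 hqm hqi hgm hgb]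

/-- **THE REJECTION TERM IS A FLOOR**: `∫ g² w r dμ ≤ ∫ g (K g) w dμ`. -/
theorem integral_sq_mul_rejection_le (hw0 : ∀ t, 0 < w t) (hwm : Measurable w)
    (hwi : Integrable w μ) (hq0 : ∀ t, 0 < q t) (hqm : Measurable q) (hqi : Integrable q μ)
    (hq1 : ∫ t, q t ∂μ = 1) {g : X → ℝ} (hgm : Measurable g) {B : ℝ} (hgb : ∀ t, |g t| ≤ B) :
    ∫ t, g t ^ 2 * w t * (∫ t', (1 - imhAcceptQ w q t t') * q t' ∂μ) ∂μ
      ≤ ∫ t, g t * imhOp μ w q g t * w t ∂μ := by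
  rw [integral_mul_imhOp_mul_eq hw0 hwm hwi hq0 hqm hqi hq1 hgm hgb]
  have h : 0 ≤ ∫ u in Ioi (0:ℝ), (∫ t, (if u < w t / q t then g t * q t else 0) ∂μ) ^ 2 :=
    integral_nonneg fun u => sq_nonneg _
  linarith

/-- **THE INDEPENDENCE SAMPLER IS A POSITIVE OPERATOR ON `L²(w dμ)`**: `0 ≤ ∫ g (K g) w dμ` for
every bounded measurable `g` (no centring needed). -/
theorem integral_mul_imhOp_mul_nonneg (hw0 : ∀ t, 0 < w t) (hwm : Measurable w)
    (hwi : Integrable w μ) (hq0 : ∀ t, 0 < q t) (hqm : Measurable q) (hqi : Integrable q μ)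
    (hq1 : ∫ t, q t ∂μ = 1) {g : X → ℝ} (hgm : Measurable g) {B : ℝ} (hgb : ∀ t, |g t| ≤ B) :
    0 ≤ ∫ t, g t * imhOp μ w q g t * w t ∂μ := by
  obtain ⟨hr0, -, -⟩ := rejection_bounds (μ := μ) hw0 hwm hq0 hqm hqi hq1
  refine le_trans (integral_nonneg fun t => ?_)
    (integral_sq_mul_rejection_le hw0 hwm hwi hq0 hqm hqi hq1 hgm hgb)
  exact mul_nonneg (mul_nonneg (sq_nonneg _) (hw0 t).le) (hr0 t)

end General

end Summit.Ventures.LatticeQCDFlow.Exactness
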